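import Mathlib

/-!
# Candidate proof of `stub_quotientWeight` (line `picard-involution-quotient`, crux stmt-KontsevichZagierPeriods-13215)

Refuter drefute — positive candidate, attached as EVIDENCE for the lead (not a proposal).
Statement verbatim from the ledger (registered 2026-08-16T04:41:05Z).  Proof: both sides are positive; their fourth
powers are rational in `t`, `√3` and `w² = (1+t+t²)/(t(1-t))`, and agree by the two `ℚ(√3)` ring facts
`2(t + (1+√3)/2)·k = (1+√3)(2t²+2t-1)` and `(1+t+t²) - (3+2√3)·t(1-t) = k²`, `k = (1+√3)t - 1`.
-/

namespace DrefuteQuotientWeight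

theorem stub_quotientWeight :
    ∀ (t : ℝ), t ∈ Set.Ioo (0:ℝ) 1 → t ≠ (Real.sqrt 3 - 1) / 2 → Real.sqrt 3 * (t + (1 + Real.sqrt 3) / 2) * (t - t ^ 4) ^ (-(3:ℝ)/4) / |(2 * t ^ 2 + 2 * t - 1) / (t * (1 - t)) ^ 2 / (2 * Real.sqrt ((1 + t + t ^ 2) / (t * (1 - t))))| = Real.sqrt 3 * (Real.sqrt 3 + 1) * (Real.sqrt ((1 + t + t ^ 2) / (t * (1 - t))) ^ 3 - (3 + 2 * Real.sqrt 3) * Real.sqrt ((1 + t + t ^ 2) / (t * (1 - t)))) ^ (-(1:ℝ)/2) := by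
  intro t ht htne
  obtain ⟨ht0, ht1⟩ := ht
  have hs2 : Real.sqrt 3 * Real.sqrt 3 = 3 := Real.mul_self_sqrt (by norm_num)
  have hs0 : 0 < Real.sqrt 3 := Real.sqrt_pos.mpr (by norm_num)
  set s := Real.sqrt 3 with hs_def
  have hu0 : 0 < t * (1 - t) := mul_pos ht0 (by linarith)
  have hp0 : 0 < 1 + t + t ^ 2 := by positivity
  have hW0 : 0 < (1 + t + t ^ 2) / (t * (1 - t)) := div_pos hp0 hu0
  set w := Real.sqrt ((1 + t + t ^ 2) / (t * (1 - t))) with hw_def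
  have hw0 : 0 < w := Real.sqrt_pos.mpr hW0
  have hw2 : w ^ 2 = (1 + t + t ^ 2) / (t * (1 - t)) := Real.sq_sqrt hW0.le
  set k := (1 + s) * t - 1 with hk_def
  -- the two ring facts over ℚ(√3)
  have hqf : 2 * (t + (1 + s) / 2) * k = (1 + s) * (2 * t ^ 2 + 2 * t - 1) := by
    rw [hk_def]; linear_combination t * hs2
  have hWD : (1 + t + t ^ 2) - (3 + 2 * s) * (t * (1 - t)) = k ^ 2 := by
    rw [hk_def]; linear_combination (-(t ^ 2)) * hs2
  have hta : 0 < t + (1 + s) / 2 := by positivity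
  have h1s : (1 + s) ≠ 0 := by positivity
  have hk0 : k ≠ 0 := by
    intro hk
    apply htne
    have h1 : (1 + s) * t = 1 := by rw [hk_def] at hk; linarith
    have h2 : t * 2 = s - 1 := by linear_combination (s - 1) * h1 - t * hs2
    linarith
  have hq0 : 2 * t ^ 2 + 2 * t - 1 ≠ 0 := by
    intro h0
    have h3 : 2 * (t + (1 + s) / 2) * k = 0 := by rw [hqf, h0, mul_zero]
    rcases mul_eq_zero.mp h3 with h | h
    · linarith
    · exact hk0 h
  have htt : t - t ^ 4 = (t * (1 - t)) * (1 + t + t ^ 2) := by ring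
  have htt0 : 0 < t - t ^ 4 := by rw [htt]; exact mul_pos hu0 hp0
  -- the base of the right-hand rpow
  have hcube : w ^ 3 - (3 + 2 * s) * w = w * k ^ 2 / (t * (1 - t)) := by
    have e : w ^ 3 - (3 + 2 * s) * w = w * (w ^ 2 - (3 + 2 * s)) := by ring
    rw [e, hw2, ← hWD]
    field_simp
  have hk2 : 0 < k ^ 2 := by positivity
  have hcube0 : 0 < w ^ 3 - (3 + 2 * s) * w := by
    rw [hcube]; positivity
  -- the weight is non-zero
  have hC0 : (2 * t ^ 2 + 2 * t - 1) / (t * (1 - t)) ^ 2 / (2 * w) ≠ 0 := by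
    apply div_ne_zero (div_ne_zero hq0 (pow_ne_zero _ hu0.ne')) (by positivity)
  -- both sides positive
  have hL0 : 0 < s * (t + (1 + s) / 2) * (t - t ^ 4) ^ (-(3:ℝ)/4) /
      |(2 * t ^ 2 + 2 * t - 1) / (t * (1 - t)) ^ 2 / (2 * w)| :=
    div_pos (mul_pos (mul_pos hs0 hta) (Real.rpow_pos_of_pos htt0 _)) (abs_pos.mpr hC0)
  have hR0 : 0 < s * (s + 1) * (w ^ 3 - (3 + 2 * s) * w) ^ (-(1:ℝ)/2) :=
    mul_pos (mul_pos hs0 (by positivity)) (Real.rpow_pos_of_pos hcube0 _)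
  -- compare fourth powers
  rw [← pow_left_inj₀ hL0.le hR0.le (by norm_num : (4:ℕ) ≠ 0)]
  have hB4 : ((t - t ^ 4) ^ (-(3:ℝ)/4)) ^ 4 = ((t - t ^ 4) ^ 3)⁻¹ := by
    rw [← Real.rpow_mul_natCast htt0.le, show (-(3:ℝ)/4) * ((4:ℕ):ℝ) = -((3:ℕ):ℝ) by norm_num,
      Real.rpow_neg htt0.le, Real.rpow_natCast]
  have hR4 : ((w ^ 3 - (3 + 2 * s) * w) ^ (-(1:ℝ)/2)) ^ 4 = ((w ^ 3 - (3 + 2 * s) * w) ^ 2)⁻¹ := by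
    rw [← Real.rpow_mul_natCast hcube0.le, show (-(1:ℝ)/2) * ((4:ℕ):ℝ) = -((2:ℕ):ℝ) by norm_num,
      Real.rpow_neg hcube0.le, Real.rpow_natCast]
  have hC4 : ((2 * t ^ 2 + 2 * t - 1) / (t * (1 - t)) ^ 2 / (2 * w)) ^ 4 =
      (2 * t ^ 2 + 2 * t - 1) ^ 4 / ((t * (1 - t)) ^ 8 * (16 * ((1 + t + t ^ 2) / (t * (1 - t))) ^ 2)) := by
    rw [div_pow, div_pow, mul_pow (2:ℝ) w 4, show w ^ 4 = (w ^ 2) ^ 2 by ring, hw2]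
    field_simp
    ring
  have hD2 : (w ^ 3 - (3 + 2 * s) * w) ^ 2 =
      ((1 + t + t ^ 2) / (t * (1 - t))) * (k ^ 2 / (t * (1 - t))) ^ 2 := by
    rw [hcube, div_pow, mul_pow, hw2]
    field_simp
  have hq : 2 * t ^ 2 + 2 * t - 1 = 2 * (t + (1 + s) / 2) * k / (1 + s) := by
    rw [hqf]; field_simp
  rw [div_pow, mul_pow, mul_pow, Even.pow_abs ⟨2, rfl⟩, hB4, hC4, mul_pow, mul_pow, hR4, hD2, hq, htt]
  have hu_ne : t * (1 - t) ≠ 0 := hu0.ne'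
  have hp_ne : 1 + t + t ^ 2 ≠ 0 := hp0.ne'
  have hta_ne : t + (1 + s) / 2 ≠ 0 := hta.ne'
  field_simp
  ring

/-- The registered ledger signature of `stub_quotientWeight` (verbatim), closed by the theorem above
(definitional match check). -/
example : (∀ (t : ℝ), t ∈ Set.Ioo (0:ℝ) 1 → t ≠ (Real.sqrt 3 - 1) / 2 → Real.sqrt 3 * (t + (1 + Real.sqrt 3) / 2) * (t - t ^ 4) ^ (-(3:ℝ)/4) / |(2 * t ^ 2 + 2 * t - 1) / (t * (1 - t)) ^ 2 / (2 * Real.sqrt ((1 + t + t ^ 2) / (t * (1 - t))))| = Real.sqrt 3 * (Real.sqrt 3 + 1) * (Real.sqrt ((1 + t + t ^ 2) / (t * (1 - t))) ^ 3 - (3 + 2 * Real.sqrt 3) * Real.sqrt ((1 + t + t ^ 2) / (t * (1 - t)))) ^ (-(1:ℝ)/2)) :=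
  stub_quotientWeight

end DrefuteQuotientWeight
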